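import Literature.NumberTheory.GaloisRepresentations.NeukirchUchidaKummerPackage
import Mathlib.FieldTheory.Galois.IsGaloisGroup
import Mathlib.FieldTheory.Finite.GaloisField
import Mathlib.NumberTheory.RamificationInertia.Galois
import Mathlib.RingTheory.Invariant.Basic
import Mathlib.RingTheory.Ideal.Pointwise
import HarnessLib

/-!
# Neukirch–Uchida, Kummer package: finite-level twins (decomposition groups of primes of `𝓞 M`)

Topic `NumberTheory/GaloisRepresentations`; namespace
`Literature.NumberTheory.GaloisRepresentations.NeukirchUchidaProof`.  PROOF-ONLY companion of
`NeukirchUchidaKummerPackage.lean` (theorems only, Mathlib-only inputs beyond that file).  The same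
Kummer package at the FINITE level of Hilbert theory: `N ⊆ M` number fields, `G = M ≃ₐ[N] M` acting on
`𝓞 M` (Mathlib `MulSemiringAction G (𝓞 M)`) and on its ideals (pointwise), `𝔔` a prime of `𝓞 M`
over `𝔮` of `𝓞 N`, decomposition group `MulAction.stabilizer G 𝔔` (Serre, *Local Fields* I §7;
Mathlib `Ideal.Quotient.stabilizerHom`, surjective onto the residue Galois group:
`Ideal.Quotient.stabilizerHom_surjective`).

* `smul_algebraMap_ringOfIntegers`, `smul_mem_of_mem_stabilizer` — bookkeeping;
* **`smul_eq_self_of_mem_stabilizer`** — RESIDUE FORMULA: `x ∈ 𝓞 M`, `x^ℓ = a ∈ 𝓞 N` with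
  `a ≡ b^ℓ (mod 𝔮)`, `b ∉ 𝔮`, `ℓ ∉ 𝔮`, `ζ_ℓ ∈ 𝓞 N` ⇒ every `σ ∈ Stab(𝔔)` fixes `x`
  (and `smul_eq_self_of_mem_stabilizer_of_sub_one_mem`, the case `a ≡ 1`);
* **`exists_mem_stabilizer_smul_ne`** — FROBENIUS NON-TRIVIALITY: if `a` is not an `ℓ`-th power
  modulo `𝔮` then some `σ ∈ Stab(𝔔)` moves `x` (`M/N` Galois; the residue extension is Galois and
  `Stab(𝔔)` surjects onto its group);
* `exists_forall_sub_pow_not_mem` (a residue which is not an `ℓ`-th power, `ℓ ∣ N𝔮 - 1` via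
  `ζ_ℓ ∈ 𝓞 N`, `ℓ ∉ 𝔮`), `exists_kummer_element` (CRT: `β` a non-`ℓ`-th power at the primes of
  `T ⊆ S` and `≡ 1` at the primes of `S ∖ T`).

Written for the abc-iut cell's GAP-LEDGER row G-L4d2g4-1, sub-DAG row R8 (extras beyond the Γ-level
currency; reusable with Mathlib's finite Hilbert theory).  HONEST FRAMING: classical (our kernel
check); nothing here bears on [IUTchIII] Cor. 3.12.

## References
* J.-P. Serre, *Local Fields* (1979), Ch. I §7 Prop. 20–22, §8 (Frobenius). [SerreLocalFields1979]
* J. Neukirch, *Algebraic Number Theory* (1999), Ch. I §9 (9.4)–(9.6). [NeukirchANT1999]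
* J. Neukirch, A. Schmidt, K. Wingberg, *Cohomology of Number Fields* (2008), (12.2.1).
  [NeukirchSchmidtWingberg2008]
-/

open scoped Pointwise NumberField
open Polynomial

namespace Literature.NumberTheory.GaloisRepresentations.NeukirchUchidaProof

/-! ### At a prime of `𝓞 M`: the residue formula and Frobenius non-triviality -/

section AtPrime

open NumberField

variable {N M : Type*} [Field N] [NumberField N] [Field M] [NumberField M] [Algebra N M]
  {ℓ : ℕ} {ζ : 𝓞 N}

omit [NumberField N] [NumberField M] in
/-- The action of `Aut(M/N)` on `𝓞 M` fixes `𝓞 N` pointwise. [folklore] -/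
private theorem smul_algebraMap_ringOfIntegers (σ : M ≃ₐ[N] M) (b : 𝓞 N) :
    σ • algebraMap (𝓞 N) (𝓞 M) b = algebraMap (𝓞 N) (𝓞 M) b := by
  apply RingOfIntegers.ext
  change σ ((algebraMap (𝓞 N) (𝓞 M) b : 𝓞 M) : M) = ((algebraMap (𝓞 N) (𝓞 M) b : 𝓞 M) : M)
  rw [RingOfIntegers.coe_eq_algebraMap, ← IsScalarTower.algebraMap_apply (𝓞 N) (𝓞 M) M,
    IsScalarTower.algebraMap_apply (𝓞 N) N M, AlgEquiv.commutes]

omit [NumberField N] [NumberField M] in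
/-- An element of the decomposition group `Stab(𝔔)` maps `𝔔` into itself (Serre, *Local Fields*
I §7, definition of `D`). [cite: SerreLocalFields1979, Ch. I §7 Prop. 20] -/
theorem smul_mem_of_mem_stabilizer {σ : M ≃ₐ[N] M} {Q : Ideal (𝓞 M)}
    (hσ : σ ∈ MulAction.stabilizer (M ≃ₐ[N] M) Q) {y : 𝓞 M} (hy : y ∈ Q) : σ • y ∈ Q := by
  have h : σ • y ∈ σ • Q := Ideal.smul_mem_pointwise_smul_iff.mpr hy
  rwa [MulAction.mem_stabilizer_iff.mp hσ] at h

omit [NumberField N] [NumberField M] in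
/-- **Residue formula for Kummer generators (finite level).**  Let `N ⊆ M` be fields with rings of
integers `𝓞 N ⊆ 𝓞 M`, `ζ ∈ 𝓞 N` a primitive `ℓ`-th root of unity (`ℓ` prime), `𝔔` a prime of `𝓞 M`
over the ideal `𝔮 ∌ ℓ` of `𝓞 N`, and `x ∈ 𝓞 M` with `x ^ ℓ = a ∈ 𝓞 N`, `a ≡ b ^ ℓ (mod 𝔮)`, `b ∉ 𝔮`.
Then every `σ` in the decomposition group `Stab(𝔔) ≤ Aut(M/N)` FIXES `x`.  Proof: `x ≡ ζ^k b (mod 𝔔)`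
for some `k`, so `σ x - x ∈ 𝔔`; but `σ x = ζ^j x` with `x ∉ 𝔔`, whence `ζ^j ≡ 1 (mod 𝔮)` and
`ζ^j = 1`.  (The Kummer character of `a` is unramified and trivial on the Frobenius at `𝔮` when `a`
is an `ℓ`-th power residue: Neukirch, *Algebraic Number Theory*, V §3, proof of (3.4)/(3.5);
Serre, *Local Fields* I §8.) [cite: NeukirchANT1999, Ch. V §3 Lemma (3.5)] -/
theorem smul_eq_self_of_mem_stabilizer (hℓ : ℓ.Prime) (hζ : IsPrimitiveRoot ζ ℓ)
    {q : Ideal (𝓞 N)} (hq : (ℓ : 𝓞 N) ∉ q) {Q : Ideal (𝓞 M)} [Q.IsPrime] [Q.LiesOver q]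
    {x : 𝓞 M} {a b : 𝓞 N} (hx : x ^ ℓ = algebraMap (𝓞 N) (𝓞 M) a) (hab : a - b ^ ℓ ∈ q)
    (hb : b ∉ q) {σ : M ≃ₐ[N] M} (hσ : σ ∈ MulAction.stabilizer (M ≃ₐ[N] M) Q) :
    σ • x = x := by
  set ι := algebraMap (𝓞 N) (𝓞 M) with hι
  have hinj : Function.Injective ι := FaithfulSMul.algebraMap_injective (𝓞 N) (𝓞 M)
  have hζM : IsPrimitiveRoot (ι ζ) ℓ := hζ.map_of_injective hinj
  -- `x ≡ ζ^k b (mod Q)` for some `k`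
  have hxb : x ^ ℓ - (ι b) ^ ℓ ∈ Q := by
    rw [hx, ← map_pow, ← map_sub]
    exact (Ideal.mem_of_liesOver Q q _).mp hab
  obtain ⟨k, -, hk⟩ := exists_sub_pow_mul_mem_of_pow_sub_pow_mem hℓ hζM hxb
  -- hence `σ • x - x ∈ Q`
  have hfix : σ • (ι ζ ^ k * ι b) = ι ζ ^ k * ι b := by
    rw [← map_pow, ← map_mul, smul_algebraMap_ringOfIntegers]
  have hdiff : σ • x - x ∈ Q := by
    have h1 : σ • (x - ι ζ ^ k * ι b) ∈ Q := smul_mem_of_mem_stabilizer hσ hk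
    rw [smul_sub, hfix] at h1
    have := Q.sub_mem h1 hk
    rwa [sub_sub_sub_cancel_right] at this
  -- and `σ • x = ζ^j x` for some `j`
  have hpow : (σ • x) ^ ℓ = x ^ ℓ := by rw [← smul_pow', hx, smul_algebraMap_ringOfIntegers]
  obtain ⟨j, -, hj⟩ := exists_eq_pow_mul_of_pow_eq_pow hℓ hζM hpow
  -- `x ∉ Q`
  have hxQ : x ∉ Q := by
    intro hxQ
    have h1 : (ι b) ^ ℓ ∈ Q := by
      have := Q.sub_mem (Q.pow_mem_of_mem hxQ ℓ hℓ.pos) hxb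
      rwa [sub_sub_cancel] at this
    have h2 : ι b ∈ Q := Ideal.IsPrime.mem_of_pow_mem inferInstance ℓ h1
    exact hb ((Ideal.mem_of_liesOver Q q b).mpr h2)
  -- so `ζ^j ≡ 1 (mod q)`, whence `ζ^j = 1`
  have hζj : (ι ζ ^ j - 1) * x ∈ Q := by rwa [sub_mul, one_mul, ← hj]
  have hζj' : ι ζ ^ j - 1 ∈ Q :=
    ((Ideal.IsPrime.mem_or_mem inferInstance hζj).resolve_right hxQ)
  have hζq : ζ ^ j - 1 ∈ q := by
    rw [Ideal.mem_of_liesOver Q q, map_sub, map_pow, map_one]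
    exact hζj'
  have hone : ζ ^ j = 1 := pow_eq_one_of_pow_sub_one_mem hℓ hζ hq hζq
  rw [hj, ← map_pow, hone, map_one, one_mul]

omit [NumberField N] [NumberField M] in
/-- Residue formula, case `a ≡ 1 (mod 𝔮)`: every `σ ∈ Stab(𝔔)` fixes the Kummer generator `x`,
`x ^ ℓ = a`. [cite: NeukirchANT1999, Ch. V §3 Lemma (3.5)] -/
theorem smul_eq_self_of_mem_stabilizer_of_sub_one_mem (hℓ : ℓ.Prime)
    (hζ : IsPrimitiveRoot ζ ℓ) {q : Ideal (𝓞 N)} (hq : (ℓ : 𝓞 N) ∉ q) {Q : Ideal (𝓞 M)}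
    [Q.IsPrime] [Q.LiesOver q] {x : 𝓞 M} {a : 𝓞 N} (hx : x ^ ℓ = algebraMap (𝓞 N) (𝓞 M) a)
    (ha : a - 1 ∈ q) {σ : M ≃ₐ[N] M} (hσ : σ ∈ MulAction.stabilizer (M ≃ₐ[N] M) Q) :
    σ • x = x := by
  have hq1 : (1 : 𝓞 N) ∉ q := fun h => hq (by simpa using q.mul_mem_left (ℓ : 𝓞 N) h)
  exact smul_eq_self_of_mem_stabilizer hℓ hζ hq hx (b := 1) (by rwa [one_pow]) hq1 hσ

/-- **Frobenius non-triviality (finite level).**  If `M/N` is a Galois extension of number fields,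
`𝔔` a prime of `𝓞 M` over `𝔮`, and `x ∈ 𝓞 M` with `x ^ ℓ = a ∈ 𝓞 N` where `a` is NOT an `ℓ`-th
power modulo `𝔮`, then some element of the decomposition group `Stab(𝔔) ≤ Gal(M/N)` moves `x`.
Proof: `Stab(𝔔)` surjects onto the Galois group of the residue extension `κ(𝔔)/κ(𝔮)` (Mathlib
`Ideal.Quotient.stabilizerHom_surjective`; Serre, *Local Fields* I §7 Prop. 20), whose fixed field is
`κ(𝔮)`; if all of `Stab(𝔔)` fixed `x`, then `x ≡ b (mod 𝔔)` with `b ∈ 𝓞 N` and `a ≡ b^ℓ (mod 𝔮)`.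
[cite: SerreLocalFields1979, Ch. I §7 Prop. 20] -/
theorem exists_mem_stabilizer_smul_ne [IsGalois N M] {q : Ideal (𝓞 N)} {Q : Ideal (𝓞 M)}
    [Q.IsMaximal] [Q.LiesOver q] {x : 𝓞 M} {a : 𝓞 N} (hx : x ^ ℓ = algebraMap (𝓞 N) (𝓞 M) a)
    (hna : ∀ b : 𝓞 N, a - b ^ ℓ ∉ q) :
    ∃ σ ∈ MulAction.stabilizer (M ≃ₐ[N] M) Q, σ • x ≠ x := by
  classical
  by_contra! hall
  have hqmax : q.IsMaximal := by rw [Q.over_def q]; infer_instance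
  letI := Ideal.Quotient.field q
  letI := Ideal.Quotient.field Q
  haveI : FiniteDimensional N M := Module.Finite.of_restrictScalars_finite ℚ N M
  set G := M ≃ₐ[N] M
  have hsurj := Ideal.Quotient.stabilizerHom_surjective G q Q
  -- `x mod Q` is fixed by the whole residue Galois group
  have hfixed : ∀ f : (𝓞 M ⧸ Q) ≃ₐ[𝓞 N ⧸ q] (𝓞 M ⧸ Q),
      f (Ideal.Quotient.mk Q x) = Ideal.Quotient.mk Q x := by
    intro f
    obtain ⟨σ, rfl⟩ := hsurj f
    rw [Ideal.Quotient.stabilizerHom_apply]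
    exact congrArg (Ideal.Quotient.mk Q) (hall σ σ.2)
  obtain ⟨c, hc⟩ := (IsGalois.mem_range_algebraMap_iff_fixed (Ideal.Quotient.mk Q x)).mpr hfixed
  obtain ⟨b, rfl⟩ := Ideal.Quotient.mk_surjective c
  rw [Ideal.Quotient.algebraMap_mk_of_liesOver, Ideal.Quotient.eq] at hc
  -- `a - b^ℓ ≡ x^ℓ - b^ℓ ≡ 0 (mod Q)`
  apply hna b
  rw [Ideal.mem_of_liesOver Q q, map_sub, ← hx, map_pow]
  obtain ⟨c, hc'⟩ := sub_dvd_pow_sub_pow x (algebraMap (𝓞 N) (𝓞 M) b) ℓ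
  rw [hc']
  exact Q.mul_mem_right c (by rw [← neg_sub]; exact Q.neg_mem hc)

end AtPrime

/-! ### Supply of `β` in the «non-`ℓ`-th power» form -/

section Supply

open NumberField

variable {N : Type*} [Field N] [NumberField N] {ℓ : ℕ} {ζ : 𝓞 N}

/-- **A residue which is not an `ℓ`-th power.**  For a maximal ideal `𝔮 ∌ ℓ` of the ring of
integers of a number field `N` containing a primitive `ℓ`-th root of unity `ζ` (`ℓ` prime), some
`r ∈ 𝓞 N` is not an `ℓ`-th power modulo `𝔮`: the `ℓ`-th power map on the finite residue field kills
`ζ mod 𝔮 ≠ 1`, so it is not injective, hence not surjective. [cite: NeukirchANT1999, Ch. V §3 Lemma (3.5)] -/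
theorem exists_forall_sub_pow_not_mem (hℓ : ℓ.Prime) (hζ : IsPrimitiveRoot ζ ℓ)
    {q : Ideal (𝓞 N)} [q.IsMaximal] (hq : (ℓ : 𝓞 N) ∉ q) :
    ∃ r : 𝓞 N, ∀ y : 𝓞 N, r - y ^ ℓ ∉ q := by
  classical
  -- the `ℓ`-th power map on the finite residue field is not injective (`ζ ↦ 1`), hence not onto
  let f : 𝓞 N ⧸ q → 𝓞 N ⧸ q := fun y => y ^ ℓ
  have hζ1 : Ideal.Quotient.mk q ζ ≠ 1 := by
    rw [Ne, ← map_one (Ideal.Quotient.mk q), Ideal.Quotient.eq]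
    exact sub_one_not_mem hℓ hζ hq
  have hnotinj : ¬ Function.Injective f := by
    intro hinj
    apply hζ1
    apply hinj
    change Ideal.Quotient.mk q ζ ^ ℓ = 1 ^ ℓ
    rw [one_pow, ← map_pow, hζ.pow_eq_one, map_one]
  have hnotsurj : ¬ Function.Surjective f := by
    rwa [← Finite.injective_iff_surjective]
  obtain ⟨c, hc⟩ := not_forall.mp hnotsurj
  obtain ⟨r, rfl⟩ := Ideal.Quotient.mk_surjective c
  refine ⟨r, fun y hy => hc ⟨Ideal.Quotient.mk q y, ?_⟩⟩
  change Ideal.Quotient.mk q y ^ ℓ = Ideal.Quotient.mk q r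
  rw [← map_pow, eq_comm, Ideal.Quotient.eq]
  exact hy

/-- **Chinese remainder supply of the Kummer element `β`**: given finitely many maximal ideals `S`
of `𝓞 N` and `T ⊆ S` with `ℓ ∉ 𝔮` for `𝔮 ∈ T` (`ζ_ℓ ∈ 𝓞 N`), there is `β ∈ 𝓞 N` which is NOT an
`ℓ`-th power modulo each `𝔮 ∈ T` and `≡ 1` modulo each `𝔮 ∈ S ∖ T` (Mathlib
`IsDedekindDomain.exists_forall_sub_mem_ideal`). [cite: NeukirchANT1999, Ch. I §3 Thm. (3.6)] -/
theorem exists_kummer_element (hℓ : ℓ.Prime) (hζ : IsPrimitiveRoot ζ ℓ)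
    (S T : Finset (Ideal (𝓞 N))) (hTS : T ⊆ S) (hmax : ∀ q ∈ S, q.IsMaximal)
    (hq : ∀ q ∈ T, (ℓ : 𝓞 N) ∉ q) :
    ∃ β : 𝓞 N, (∀ q ∈ T, ∀ y : 𝓞 N, β - y ^ ℓ ∉ q) ∧ (∀ q ∈ S, q ∉ T → β - 1 ∈ q) := by
  classical
  -- targets: a non-`ℓ`-th power at the primes of `T`, `1` elsewhere
  have hr : ∀ q : Ideal (𝓞 N), ∃ r : 𝓞 N, q ∈ T → ∀ y : 𝓞 N, r - y ^ ℓ ∉ q := by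
    intro q
    by_cases hqT : q ∈ T
    · haveI := hmax q (hTS hqT)
      obtain ⟨r, hr⟩ := exists_forall_sub_pow_not_mem hℓ hζ (hq q hqT)
      exact ⟨r, fun _ => hr⟩
    · exact ⟨1, fun h => (hqT h).elim⟩
  choose r hr using hr
  let x : S → 𝓞 N := fun q => if (q : Ideal (𝓞 N)) ∈ T then r q else 1
  have hprime : ∀ q ∈ S, Prime q := fun q hqS =>
    Ideal.prime_of_isPrime (Ring.ne_bot_of_isMaximal_of_not_isField (hmax q hqS)
      (RingOfIntegers.not_isField N)) (hmax q hqS).isPrime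
  obtain ⟨β, hβ⟩ := IsDedekindDomain.exists_forall_sub_mem_ideal (fun q : Ideal (𝓞 N) => q)
    (fun _ => 1) hprime (fun _ _ _ _ h => h) x
  refine ⟨β, fun q hqT y hy => ?_, fun q hqS hqT => ?_⟩
  · have h1 : β - r q ∈ q := by
      have := hβ q (hTS hqT)
      simp only [x, if_pos hqT, pow_one] at this
      exact this
    apply hr q hqT y
    have : r q - y ^ ℓ = (β - y ^ ℓ) - (β - r q) := by ring
    rw [this]
    exact q.sub_mem hy h1
  · have := hβ q hqS
    simp only [x, if_neg hqT, pow_one] at this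
    exact this

end Supply

end Literature.NumberTheory.GaloisRepresentations.NeukirchUchidaProof
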